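import Mathlib
import Summits.ValiantsHypothesis.ValiantsHypothesis.Theorems.PerDivisionHard.Negative.PerSupportBound
import Summits.ValiantsHypothesis.ValiantsHypothesis.Theorems.DivisionGapPerMultiplesHardStubTypedDecompositionL
import Summits.ValiantsHypothesis.ValiantsHypothesis.Theorems.DivisionGapPerMultiplesHardStubBoardCompression
import Summits.ValiantsHypothesis.ValiantsHypothesis.Theorems.DivisionGapPerMultiplesHardStubSharpChoose

/-!
# `DivisionGap.PerMultiplesHard` (stmt-ValiantsHypothesis-5068), line `uncharged-face-walk`:
the DEEP richness engine (stub `richFacesDeep`, one-sided depth 2)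

For `n ≥ 9` and every set of cells `G ⊆ [n]²`, the face permanent
`per_G := Σ_{σ ⊆ G} x^{μ_σ}` satisfies, with `k₀ := ⌊n/3⌋ + 1` and `L := L⁺(per_G)` (the tree's
monotone fan-in-two `complexity` over `ℝ≥0`),

  `#PM(G) · 3^n · 3^{k₀} ≤ L² · n! · (n+1) · (k₀+1) · 2^{n - ⌊n/3⌋} · 2^{k₀ - ⌊k₀/3⌋}`

(`≈ #PM(G) · 2^{1.22 n} ≤ L² · n! · poly(n)`; the cheap factor of the one-level Jerrum–Snir
decomposition is decomposed once more).  Proof, composing landed theorems of the line: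
0. `supp per_G = μ(PM(G))` has `#PM(G)` elements, all with unit row and column sums.
1. `TypedDecompositionL.stub_typedDecompositionL` (`D = 3`): `per_G = Σ_{t<s} a_t b_t`, `s ≤ L`,
   `L(a_t) ≤ L`, `a_t` typed `(ρ, γ)` with `n < 3k ≤ 2n`, `k = #{ρ ≠ 0}`.
2. Per term (`card_support_mul_typed_le`): the unit margins of `a_t b_t` split into complementary
   `0/1` margins `𝟙_S/𝟙_T` of `a_t` and `𝟙_{Sᶜ}/𝟙_{Tᶜ}` of `b_t` (`margins_split`); board
   compression (`BoardCompression.stub_boardCompression`) moves `a_t` to the `k`-board inside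
   `supp per_k` and `b_t` to the `(n-k)`-board inside `supp per_{n-k}` (so `#supp b_t ≤ (n-k)!`);
   Jerrum–Snir by sub-support with the exact window binomial (`exists_sharp_degree`) and
   `SharpChoose.stub_sharpChoose` give `#supp a_t · 3^k ≤ (k+1) 2^{k-⌊k/3⌋} L(a_t) k!`
   (`card_support_typed_factor_le`); then `3^n ≤ (n+1) C(n,k) 2^{n-⌊n/3⌋}`,
   `C(n,k) k! (n-k)! = n!`, and the monotonicity of `3^k / ((k+1) 2^{k-⌊k/3⌋})` in `k ≥ k₀`.
3. Sum over the `s ≤ L` terms (`support_sum`, `card_biUnion_le`). [cite: JerrumSnir1982, §3–§4.3]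
-/

noncomputable section

set_option linter.dupNamespace false

open MvPolynomial Literature.Computability.AlgebraicComplexity
open scoped NNReal BigOperators
open Literature.Barriers.ValiantsHypothesis
open Summit.ValiantsHypothesis.ValiantsHypothesis.Theorems.PerDivisionHard.Negative
open Summit.ValiantsHypothesis.ValiantsHypothesis.Theorems.DivisionGap.PerMultiplesHard

namespace Summit.ValiantsHypothesis.ValiantsHypothesis.Theorems.DivisionGap.PerMultiplesHard.RichFacesDeep

/-! ### Arithmetic: `3^k / ((k+1) · 2^{k - ⌊k/3⌋})` is non-decreasing in `k ≥ 1` -/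

/-- One step of the monotonicity: `(j+2) · 2^{(j+1) - ⌊(j+1)/3⌋} ≤ 3 · (j+1) · 2^{j - ⌊j/3⌋}` for
`j ≥ 1` (the exponent grows by at most one and `2(j+2) ≤ 3(j+1)`). [folklore] -/
theorem succ_step_le (j : ℕ) (hj : 1 ≤ j) :
    (j + 1 + 1) * 2 ^ (j + 1 - (j + 1) / 3) ≤ 3 * ((j + 1) * 2 ^ (j - j / 3)) := by
  have hexp : j + 1 - (j + 1) / 3 ≤ j - j / 3 + 1 := by omega
  calc (j + 1 + 1) * 2 ^ (j + 1 - (j + 1) / 3) ≤ (j + 1 + 1) * 2 ^ (j - j / 3 + 1) :=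
        Nat.mul_le_mul_left _ (Nat.pow_le_pow_right (by norm_num) hexp)
    _ = 2 * (j + 1 + 1) * 2 ^ (j - j / 3) := by ring
    _ ≤ 3 * (j + 1) * 2 ^ (j - j / 3) := Nat.mul_le_mul_right _ (by omega)
    _ = 3 * ((j + 1) * 2 ^ (j - j / 3)) := by ring

/-- Monotonicity of `k ↦ 3^k / ((k+1) · 2^{k - ⌊k/3⌋})` on `k ≥ 1`, in cross-multiplied integer
form: for `1 ≤ k₀ ≤ k`, `3^{k₀} · ((k+1) · 2^{k-⌊k/3⌋}) ≤ 3^k · ((k₀+1) · 2^{k₀-⌊k₀/3⌋})`.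
[folklore] -/
theorem three_pow_mul_le_three_pow_mul {k₀ k : ℕ} (hk₀ : 1 ≤ k₀) (hk : k₀ ≤ k) :
    3 ^ k₀ * ((k + 1) * 2 ^ (k - k / 3)) ≤ 3 ^ k * ((k₀ + 1) * 2 ^ (k₀ - k₀ / 3)) := by
  induction k, hk using Nat.le_induction with
  | base => exact le_rfl
  | succ j hj ih =>
    calc 3 ^ k₀ * ((j + 1 + 1) * 2 ^ (j + 1 - (j + 1) / 3))
        ≤ 3 ^ k₀ * (3 * ((j + 1) * 2 ^ (j - j / 3))) :=
          Nat.mul_le_mul_left _ (succ_step_le j (by omega))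
      _ = 3 * (3 ^ k₀ * ((j + 1) * 2 ^ (j - j / 3))) := by ring
      _ ≤ 3 * (3 ^ j * ((k₀ + 1) * 2 ^ (k₀ - k₀ / 3))) := Nat.mul_le_mul_left _ ih
      _ = 3 ^ (j + 1) * ((k₀ + 1) * 2 ^ (k₀ - k₀ / 3)) := by ring

/-! ### Jerrum–Snir by sub-support with the exact window binomial -/

-- adapted from Theorems/DivisionGapPerMultiplesHardStubSharpSubSupportCount.lean (p108396,
-- `stub_sharpSubSupportCount`; restated here so that this module does not import it)
/-- **Jerrum–Snir by SUB-support with the exact binomial.**  For `m ≥ 3` and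
`supp p ⊆ supp per_m` there is a degree `d` in the window `m < 3d ≤ 2m` with
`#supp p · C(m,d) ≤ L⁺(p) · m!`: take `d ∈ (m/3, 2(m/3)]` minimising `C(m, ·)` and a minimal
fan-in-two circuit; its balanced decomposition `p = Σ_t a_t b_t` (`exists_decomposition`, at most
`L⁺(p)` terms) has `deg a_t` in the window and `supp (a_t b_t) ⊆ supp per_m` (no cancellation), so
`#supp (a_t b_t) · C(m,d) ≤ #supp (a_t b_t) · C(m, deg a_t) ≤ m!` by the rectangle bound
`card_support_mul_choose_le`; sum over `t`. [cite: JerrumSnir1982, §4.3 and Cor. 3.5] -/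
theorem exists_sharp_degree {m : ℕ} (hm : 3 ≤ m) (p : MvPolynomial (Fin m × Fin m) ℝ≥0)
    (hp : p.support ⊆ (perPoly (Fin m) ℝ≥0).support) :
    ∃ d : ℕ, m < 3 * d ∧ 3 * d ≤ 2 * m ∧
      p.support.card * m.choose d ≤ complexity p * m.factorial := by
  classical
  obtain ⟨d, hd, hmin⟩ := Finset.exists_min_image (Finset.Ioc (m / 3) (2 * (m / 3)))
    (fun d => m.choose d) ⟨m / 3 + 1, Finset.mem_Ioc.mpr ⟨by omega, by omega⟩⟩
  obtain ⟨hd1, hd2⟩ := Finset.mem_Ioc.mp hd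
  refine ⟨d, by omega, by omega, ?_⟩
  obtain ⟨P, hP2, hP, hsize⟩ := ArithCircuit.exists_computes_size_eq_complexity p
  have heval : P.eval = p := hP
  have hhom : p.IsHomogeneous m := fun e he => by
    have := perPoly_isHomogeneous (n := Fin m) (k := ℝ≥0)
      (mem_support_iff.mp (hp (mem_support_iff.mpr he)))
    rwa [Fintype.card_fin] at this
  obtain ⟨L, hLlen, hLsum, hLdeg⟩ := exists_decomposition (m := m / 3) (d := m) (by omega)
    (by omega) _ P le_rfl hP2 (by rw [heval]; exact hhom)
  rw [heval] at hLsum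
  have hterm : ∀ ab ∈ L, (ab.1 * ab.2).support.card * m.choose d ≤ m.factorial := by
    intro ab hab
    by_cases hb : ab.2 = 0
    · simp [hb]
    have hdeg := hLdeg ab hab
    have ha : ab.1 ≠ 0 := fun ha => by rw [ha, totalDegree_zero] at hdeg; omega
    obtain ⟨q, hq⟩ :=
      exists_sum_eq_add_of_mem (fun ab : MvPolynomial _ ℝ≥0 × _ => ab.1 * ab.2) L ab hab
    obtain ⟨hcard, -⟩ :=
      card_support_mul_choose_le ((support_subset_of_eq_add (hLsum.trans hq)).trans hp) ha hb
    exact (Nat.mul_le_mul_left _ (hmin _ (Finset.mem_Ioc.mpr hdeg))).trans hcard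
  have hsupp : p.support.card ≤ (L.map fun ab => (ab.1 * ab.2).support.card).sum := by
    rw [hLsum]
    clear hLsum hLlen hLdeg hterm
    induction L with
    | nil => simp
    | cons ab L ih =>
      simp only [List.map_cons, List.sum_cons]
      exact (Finset.card_le_card support_add).trans
        ((Finset.card_union_le _ _).trans (Nat.add_le_add_left ih _))
  calc p.support.card * m.choose d
      ≤ (L.map fun ab => (ab.1 * ab.2).support.card).sum * m.choose d :=
        Nat.mul_le_mul_right _ hsupp
    _ = (L.map fun ab => (ab.1 * ab.2).support.card * m.choose d).sum := by
        rw [List.sum_map_mul_right]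
    _ ≤ (L.map fun _ => m.factorial).sum := List.sum_le_sum hterm
    _ = L.length * m.factorial := by rw [List.map_const', List.sum_replicate, smul_eq_mul]
    _ ≤ complexity p * m.factorial :=
        Nat.mul_le_mul_right _ (hLlen.trans (hsize ▸ prodCount_le_size P))

/-! ### Typed factors of a unit-margin product have complementary `0/1` margins -/

section Margins

variable {n : ℕ} {a b : MvPolynomial (Fin n × Fin n) ℝ≥0}

/-- Over `ℝ≥0`, `α ∈ supp a` and `β ∈ supp b` give `α + β ∈ supp (a · b)` (`support_mul_eq`); if
all monomials of `a · b` have unit margins, the margins of `α` and `β` add up to `1` in every row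
and every column. [cite: JerrumSnir1982, §2.2 and §4.3] -/
theorem margins_add_eq_one
    (hab : ∀ m ∈ (a * b).support, (∀ i, ∑ j, m (i, j) = 1) ∧ (∀ j, ∑ i, m (i, j) = 1))
    {α β : (Fin n × Fin n) →₀ ℕ} (hα : α ∈ a.support) (hβ : β ∈ b.support) :
    (∀ i, ∑ j, α (i, j) + ∑ j, β (i, j) = 1) ∧ (∀ j, ∑ i, α (i, j) + ∑ i, β (i, j) = 1) := by
  classical
  have hmem : α + β ∈ (a * b).support := by
    rw [JerrumSnir.support_mul_eq]
    exact Finset.add_mem_add hα hβ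
  obtain ⟨hr, hc⟩ := hab _ hmem
  refine ⟨fun i => ?_, fun j => ?_⟩
  · simpa only [Finsupp.coe_add, Pi.add_apply, Finset.sum_add_distrib] using hr i
  · simpa only [Finsupp.coe_add, Pi.add_apply, Finset.sum_add_distrib] using hc j

/-- **Margin splitting.** If all monomials of `a · b` (over `ℝ≥0`, `a, b ≠ 0`) have unit row and
column sums and `a` is typed with margins `(ρ, γ)`, then `ρ = 𝟙_S`, `γ = 𝟙_T` for
`S = {ρ ≠ 0}`, `T = {γ ≠ 0}`, every monomial of `b` has the complementary margins
`𝟙_{Sᶜ}, 𝟙_{Tᶜ}`, and `#T = #S` (both are the degree of any monomial of `a`).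
[cite: JerrumSnir1982, §4.3 (p. 887–888)] -/
theorem margins_split {ρ γ : Fin n → ℕ} (ha0 : a ≠ 0) (hb0 : b ≠ 0)
    (hab : ∀ m ∈ (a * b).support, (∀ i, ∑ j, m (i, j) = 1) ∧ (∀ j, ∑ i, m (i, j) = 1))
    (ha : ∀ m ∈ a.support, (∀ i, ∑ j, m (i, j) = ρ i) ∧ (∀ j, ∑ i, m (i, j) = γ j)) :
    (∀ m ∈ a.support,
      (∀ i, ∑ j, m (i, j) = if i ∈ Finset.univ.filter (fun i => ρ i ≠ 0) then 1 else 0) ∧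
      (∀ j, ∑ i, m (i, j) = if j ∈ Finset.univ.filter (fun j => γ j ≠ 0) then 1 else 0)) ∧
    (∀ m ∈ b.support,
      (∀ i, ∑ j, m (i, j) = if i ∈ (Finset.univ.filter (fun i => ρ i ≠ 0))ᶜ then 1 else 0) ∧
      (∀ j, ∑ i, m (i, j) = if j ∈ (Finset.univ.filter (fun j => γ j ≠ 0))ᶜ then 1 else 0)) ∧
    (Finset.univ.filter (fun j => γ j ≠ 0)).card =
      (Finset.univ.filter (fun i => ρ i ≠ 0)).card := by
  classical
  obtain ⟨α₀, hα₀⟩ := support_nonempty.mpr ha0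
  obtain ⟨β₀, hβ₀⟩ := support_nonempty.mpr hb0
  -- the margins of every `β ∈ supp b` complement `(ρ, γ)`
  have hrow : ∀ β ∈ b.support, ∀ i, ρ i + ∑ j, β (i, j) = 1 := fun β hβ i => by
    have h := (margins_add_eq_one hab hα₀ hβ).1 i
    rwa [(ha α₀ hα₀).1 i] at h
  have hcol : ∀ β ∈ b.support, ∀ j, γ j + ∑ i, β (i, j) = 1 := fun β hβ j => by
    have h := (margins_add_eq_one hab hα₀ hβ).2 j
    rwa [(ha α₀ hα₀).2 j] at h
  have hρ : ∀ i, ρ i ≤ 1 := fun i => by have := hrow β₀ hβ₀ i; omega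
  have hγ : ∀ j, γ j ≤ 1 := fun j => by have := hcol β₀ hβ₀ j; omega
  simp only [Finset.mem_compl, Finset.mem_filter, Finset.mem_univ, true_and]
  refine ⟨fun m hm => ⟨fun i => ?_, fun j => ?_⟩, fun m hm => ⟨fun i => ?_, fun j => ?_⟩, ?_⟩
  · have := hρ i; rw [(ha m hm).1 i]; split_ifs <;> omega
  · have := hγ j; rw [(ha m hm).2 j]; split_ifs <;> omega
  · have := hrow m hm i; split_ifs <;> omega
  · have := hcol m hm j; split_ifs <;> omega
  · -- `#T = Σ_j γ j = deg α₀ = Σ_i ρ i = #S`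
    have hS : (Finset.univ.filter (fun i => ρ i ≠ 0)).card = ∑ i, ρ i := by
      rw [Finset.card_eq_sum_ones, Finset.sum_filter]
      exact Finset.sum_congr rfl fun i _ => by have := hρ i; split_ifs <;> omega
    have hT : (Finset.univ.filter (fun j => γ j ≠ 0)).card = ∑ j, γ j := by
      rw [Finset.card_eq_sum_ones, Finset.sum_filter]
      exact Finset.sum_congr rfl fun j _ => by have := hγ j; split_ifs <;> omega
    rw [hS, hT]
    calc ∑ j, γ j = ∑ j, ∑ i, α₀ (i, j) := Finset.sum_congr rfl fun j _ => ((ha α₀ hα₀).2 j).symm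
      _ = ∑ i, ∑ j, α₀ (i, j) := Finset.sum_comm
      _ = ∑ i, ρ i := Finset.sum_congr rfl fun i _ => (ha α₀ hα₀).1 i

end Margins

/-! ### The per-factor bounds -/

section Factors

variable {n k : ℕ}

/-- **The deep bound for a typed factor** (`a`-side).  If every monomial of `a` (over `ℝ≥0`, on
the `n × n` board) has row margins `𝟙_S` and column margins `𝟙_T` with `#S = #T = k ≥ 3`, then
`#supp a · 3^k ≤ (k+1) · 2^{k-⌊k/3⌋} · L(a) · k!`: compress `a` to the `k`-board
(`stub_boardCompression`: same number of monomials, inside `supp per_k`, no dearer), then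
`exists_sharp_degree` (`#supp · C(k,d) ≤ L · k!` for some `k < 3d ≤ 2k`) and the entropy bound
`3^k ≤ (k+1) C(k,d) 2^{k-⌊k/3⌋}` (`stub_sharpChoose`). [cite: JerrumSnir1982, §4.3 and Cor. 3.5] -/
theorem card_support_typed_factor_le (hk : 3 ≤ k) (S T : Finset (Fin n)) (hS : S.card = k)
    (hT : T.card = k) (a : MvPolynomial (Fin n × Fin n) ℝ≥0)
    (ha : ∀ m ∈ a.support, (∀ i, ∑ j, m (i, j) = if i ∈ S then 1 else 0) ∧
      (∀ j, ∑ i, m (i, j) = if j ∈ T then 1 else 0)) :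
    a.support.card * 3 ^ k ≤ (k + 1) * 2 ^ (k - k / 3) * (complexity a * k.factorial) := by
  obtain ⟨a', hsub, hcard, hcompl⟩ :=
    BoardCompression.stub_boardCompression n k S T a hS hT ha
  obtain ⟨d, hd1, hd2, hcount⟩ := exists_sharp_degree hk a' hsub
  have h3 := SharpChoose.stub_sharpChoose k d hd1 hd2
  calc a.support.card * 3 ^ k
      ≤ a.support.card * ((k + 1) * k.choose d * 2 ^ (k - k / 3)) := Nat.mul_le_mul_left _ h3
    _ = (k + 1) * 2 ^ (k - k / 3) * (a'.support.card * k.choose d) := by rw [hcard]; ring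
    _ ≤ (k + 1) * 2 ^ (k - k / 3) * (complexity a' * k.factorial) := Nat.mul_le_mul_left _ hcount
    _ ≤ (k + 1) * 2 ^ (k - k / 3) * (complexity a * k.factorial) :=
        Nat.mul_le_mul_left _ (Nat.mul_le_mul_right _ hcompl)

/-- **The count bound for a typed factor** (`b`-side).  If every monomial of `b` has row margins
`𝟙_S` and column margins `𝟙_T` with `#S = #T = k`, then `#supp b ≤ k!`: compress `b` to the
`k`-board (`stub_boardCompression`), where its support lies in `supp per_k`, of size `k!`
(`JerrumSnir.card_support_perPoly`). [cite: JerrumSnir1982, §4.3 (p. 887–888)] -/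
theorem card_support_le_factorial (S T : Finset (Fin n)) (hS : S.card = k) (hT : T.card = k)
    (b : MvPolynomial (Fin n × Fin n) ℝ≥0)
    (hb : ∀ m ∈ b.support, (∀ i, ∑ j, m (i, j) = if i ∈ S then 1 else 0) ∧
      (∀ j, ∑ i, m (i, j) = if j ∈ T then 1 else 0)) :
    b.support.card ≤ k.factorial := by
  obtain ⟨b', hsub, hcard, -⟩ := BoardCompression.stub_boardCompression n k S T b hS hT hb
  rw [← hcard, ← JerrumSnir.card_support_perPoly (n := k) ℝ≥0]
  exact Finset.card_le_card hsub

/-- **The deep bound for a typed product with complementary `0/1` margins.**  For `n ≥ 9`,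
`n < 3k ≤ 2n`, `#S = #T = k`, `a` with margins `𝟙_S/𝟙_T` and `L(a) ≤ L`, `b` with margins
`𝟙_{Sᶜ}/𝟙_{Tᶜ}`, and `k₀ = ⌊n/3⌋ + 1`:
`#supp (a b) · 3^n · 3^{k₀} ≤ L · n! · (n+1) (k₀+1) · 2^{n-⌊n/3⌋} 2^{k₀-⌊k₀/3⌋}` — from
`#supp (a b) ≤ #supp a · #supp b` (`support_mul_eq`), the two factor bounds,
`3^n ≤ (n+1) C(n,k) 2^{n-⌊n/3⌋}` (`stub_sharpChoose`), `C(n,k) k! (n-k)! = n!`, and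
`three_pow_mul_le_three_pow_mul` to pass from `k` to `k₀ ≤ k`. [cite: JerrumSnir1982, §3–§4.3] -/
theorem card_support_mul_le_of_margins {L : ℕ} (hn : 9 ≤ n) (hk1 : n < 3 * k)
    (hk2 : 3 * k ≤ 2 * n) (S T : Finset (Fin n)) (hS : S.card = k) (hT : T.card = k)
    {a b : MvPolynomial (Fin n × Fin n) ℝ≥0}
    (ha : ∀ m ∈ a.support, (∀ i, ∑ j, m (i, j) = if i ∈ S then 1 else 0) ∧
      (∀ j, ∑ i, m (i, j) = if j ∈ T then 1 else 0))
    (hb : ∀ m ∈ b.support, (∀ i, ∑ j, m (i, j) = if i ∈ Sᶜ then 1 else 0) ∧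
      (∀ j, ∑ i, m (i, j) = if j ∈ Tᶜ then 1 else 0))
    (hL : complexity a ≤ L) :
    (a * b).support.card * (3 ^ n * 3 ^ (n / 3 + 1)) ≤
      L * (n.factorial * ((n + 1) * (n / 3 + 2) *
        (2 ^ (n - n / 3) * 2 ^ ((n / 3 + 1) - (n / 3 + 1) / 3)))) := by
  classical
  have hkn : k ≤ n := by omega
  have hA := card_support_typed_factor_le (by omega) S T hS hT a ha
  have hSc : Sᶜ.card = n - k := by rw [Finset.card_compl, Fintype.card_fin, hS]
  have hTc : Tᶜ.card = n - k := by rw [Finset.card_compl, Fintype.card_fin, hT]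
  have hB := card_support_le_factorial Sᶜ Tᶜ hSc hTc b hb
  have hAB : (a * b).support.card ≤ a.support.card * b.support.card := by
    rw [JerrumSnir.support_mul_eq]
    exact Finset.card_add_le
  have h3n := SharpChoose.stub_sharpChoose n k hk1 hk2
  have hfact : n.choose k * k.factorial * (n - k).factorial = n.factorial :=
    Nat.choose_mul_factorial_mul_factorial hkn
  have hmono := three_pow_mul_le_three_pow_mul (k₀ := n / 3 + 1) (k := k) (by omega) (by omega)
  -- the bound at the true row support `k`
  have key : (a * b).support.card * 3 ^ n * 3 ^ k ≤
      L * n.factorial * (n + 1) * 2 ^ (n - n / 3) * ((k + 1) * 2 ^ (k - k / 3)) := by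
    calc (a * b).support.card * 3 ^ n * 3 ^ k
        ≤ a.support.card * b.support.card * ((n + 1) * n.choose k * 2 ^ (n - n / 3)) * 3 ^ k :=
          Nat.mul_le_mul_right _ (Nat.mul_le_mul hAB h3n)
      _ = a.support.card * 3 ^ k * b.support.card * ((n + 1) * n.choose k * 2 ^ (n - n / 3)) := by
          ring
      _ ≤ (k + 1) * 2 ^ (k - k / 3) * (complexity a * k.factorial) * (n - k).factorial *
            ((n + 1) * n.choose k * 2 ^ (n - n / 3)) :=
          Nat.mul_le_mul_right _ (Nat.mul_le_mul hA hB)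
      _ = complexity a * (n.choose k * k.factorial * (n - k).factorial) * (n + 1) *
            2 ^ (n - n / 3) * ((k + 1) * 2 ^ (k - k / 3)) := by ring
      _ ≤ L * n.factorial * (n + 1) * 2 ^ (n - n / 3) * ((k + 1) * 2 ^ (k - k / 3)) := by
          rw [hfact]
          gcongr
  -- pass from `k` to `k₀ = n/3 + 1 ≤ k` and cancel `3^k`
  refine Nat.le_of_mul_le_mul_right ?_ (pow_pos (by norm_num : (0 : ℕ) < 3) k)
  calc (a * b).support.card * (3 ^ n * 3 ^ (n / 3 + 1)) * 3 ^ k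
      = (a * b).support.card * 3 ^ n * 3 ^ k * 3 ^ (n / 3 + 1) := by ring
    _ ≤ L * n.factorial * (n + 1) * 2 ^ (n - n / 3) * ((k + 1) * 2 ^ (k - k / 3)) *
          3 ^ (n / 3 + 1) := Nat.mul_le_mul_right _ key
    _ = L * n.factorial * (n + 1) * 2 ^ (n - n / 3) *
          (3 ^ (n / 3 + 1) * ((k + 1) * 2 ^ (k - k / 3))) := by ring
    _ ≤ L * n.factorial * (n + 1) * 2 ^ (n - n / 3) *
          (3 ^ k * ((n / 3 + 1 + 1) * 2 ^ ((n / 3 + 1) - (n / 3 + 1) / 3))) :=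
        Nat.mul_le_mul_left _ hmono
    _ = L * (n.factorial * ((n + 1) * (n / 3 + 2) *
          (2 ^ (n - n / 3) * 2 ^ ((n / 3 + 1) - (n / 3 + 1) / 3)))) * 3 ^ k := by ring

/-- **The per-term lemma.**  If all monomials of `g` have unit row and column sums,
`supp (a b) ⊆ supp g` (a term of a decomposition of `g` over `ℝ≥0`), `a` is typed with margins
`(ρ, γ)` whose row support `k = #{ρ ≠ 0}` lies in the window `n < 3k ≤ 2n`, `n ≥ 9`, and
`L(a) ≤ L`, then, with `k₀ = ⌊n/3⌋ + 1`,
`#supp (a b) · 3^n · 3^{k₀} ≤ L · n! · (n+1) (k₀+1) · 2^{n-⌊n/3⌋} 2^{k₀-⌊k₀/3⌋}`: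
trivial if `a = 0` or `b = 0`, else `margins_split` and `card_support_mul_le_of_margins`.
[cite: JerrumSnir1982, §3–§4.3] -/
theorem card_support_mul_typed_le {L : ℕ} (hn : 9 ≤ n) {g a b : MvPolynomial (Fin n × Fin n) ℝ≥0}
    (hg : ∀ m ∈ g.support, (∀ i, ∑ j, m (i, j) = 1) ∧ (∀ j, ∑ i, m (i, j) = 1))
    (hsub : (a * b).support ⊆ g.support) {ρ γ : Fin n → ℕ}
    (ha : ∀ m ∈ a.support, (∀ i, ∑ j, m (i, j) = ρ i) ∧ (∀ j, ∑ i, m (i, j) = γ j))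
    (hk1 : n < 3 * (Finset.univ.filter fun i => ρ i ≠ 0).card)
    (hk2 : 3 * (Finset.univ.filter fun i => ρ i ≠ 0).card ≤ 2 * n)
    (hL : complexity a ≤ L) :
    (a * b).support.card * (3 ^ n * 3 ^ (n / 3 + 1)) ≤
      L * (n.factorial * ((n + 1) * (n / 3 + 2) *
        (2 ^ (n - n / 3) * 2 ^ ((n / 3 + 1) - (n / 3 + 1) / 3)))) := by
  by_cases ha0 : a = 0
  · simp [ha0]
  by_cases hb0 : b = 0
  · simp [hb0]
  obtain ⟨haS, hbS, hTS⟩ := margins_split ha0 hb0 (fun m hm => hg m (hsub hm)) ha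
  exact card_support_mul_le_of_margins hn hk1 hk2 _ _ rfl hTS haS hbS hL

end Factors

/-- **richFacesDeep — the deep richness engine (one-sided depth 2).**  For `n ≥ 9` and every
`G ⊆ [n]²`, with `per_G = Σ_{σ ⊆ G} x^{μ_σ}`, `#PM(G)` the number of permutations inside `G`,
`L = L⁺(per_G)` and `k₀ = ⌊n/3⌋ + 1`:
`#PM(G) · 3^n · 3^{k₀} ≤ L² · n! · (n+1) (k₀+1) · 2^{n-⌊n/3⌋} · 2^{k₀-⌊k₀/3⌋}`.
Typed decomposition `per_G = Σ_{t<s} a_t b_t` (`stub_typedDecompositionL`, `D = 3`, `s ≤ L`,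
`L(a_t) ≤ L`), the per-term lemma `card_support_mul_typed_le`, and
`#PM(G) = #supp per_G ≤ Σ_t #supp (a_t b_t)`. [cite: JerrumSnir1982, §3–§4.3] -/
theorem richFacesDeep : ∀ n ≥ 9, ∀ G : Finset (Fin n × Fin n),
    ((Finset.univ : Finset (Equiv.Perm (Fin n))).filter (fun σ => ∀ i, (σ i, i) ∈ G)).card *
        (3 ^ n * 3 ^ (n / 3 + 1)) ≤
      complexity (∑ σ ∈ (Finset.univ : Finset (Equiv.Perm (Fin n))).filter
          (fun σ => ∀ i, (σ i, i) ∈ G), monomial (permMonomial σ) (1 : ℝ≥0)) ^ 2 *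
        (n.factorial * ((n + 1) * (n / 3 + 2) *
          (2 ^ (n - n / 3) * 2 ^ ((n / 3 + 1) - (n / 3 + 1) / 3)))) := by
  intro n hn G
  classical
  set PM := (Finset.univ : Finset (Equiv.Perm (Fin n))).filter (fun σ => ∀ i, (σ i, i) ∈ G)
  set g : MvPolynomial (Fin n × Fin n) ℝ≥0 := ∑ σ ∈ PM, monomial (permMonomial σ) (1 : ℝ≥0)
  set M := n.factorial * ((n + 1) * (n / 3 + 2) *
    (2 ^ (n - n / 3) * 2 ^ ((n / 3 + 1) - (n / 3 + 1) / 3)))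
  -- `supp g = μ(PM(G))`: distinct exponents, coefficients `1`
  have hmem : ∀ d, d ∈ g.support ↔ ∃ σ ∈ PM, permMonomial σ = d := fun d =>
    BoardCompression.mem_support_sum_monomial_iff permMonomial_injective.injOn
      (fun _ _ => one_ne_zero) d
  have hsupp : g.support = PM.image permMonomial := by
    ext d
    rw [hmem, Finset.mem_image]
  have hcard : g.support.card = PM.card := by
    rw [hsupp, Finset.card_image_of_injective _ permMonomial_injective]
  have hg : ∀ m ∈ g.support, (∀ i, ∑ j, m (i, j) = 1) ∧ (∀ j, ∑ i, m (i, j) = 1) := by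
    intro m hm
    obtain ⟨σ, -, rfl⟩ := (hmem m).1 hm
    exact ⟨fun i => rowCount_permMonomial σ i, fun j => colCount_permMonomial σ j⟩
  obtain ⟨s, hsL, a, b, hgab, ht⟩ := TypedDecompositionL.stub_typedDecompositionL n 3 le_rfl
    (by omega) g (fun _ => 1) (fun _ => 1) hg (fun _ => one_ne_zero)
  -- every term is bounded by the per-term lemma
  have hterm : ∀ t, (a t * b t).support.card * (3 ^ n * 3 ^ (n / 3 + 1)) ≤ complexity g * M := by
    intro t
    obtain ⟨hLt, ρ, γ, hty, hk1, hk2⟩ := ht t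
    have hsub : (a t * b t).support ⊆ g.support := by
      refine support_subset_of_eq_add (q := ∑ t' ∈ Finset.univ.erase t, a t' * b t') ?_
      rw [Finset.add_sum_erase _ (fun t' => a t' * b t') (Finset.mem_univ t)]
      exact hgab
    exact card_support_mul_typed_le hn hg hsub hty hk1 hk2 hLt
  -- no cancellation: `#supp g ≤ Σ_t #supp (a_t b_t)`
  have hsum : g.support.card ≤ ∑ t, (a t * b t).support.card := by
    conv_lhs => rw [hgab]
    exact (Finset.card_le_card support_sum).trans Finset.card_biUnion_le
  calc PM.card * (3 ^ n * 3 ^ (n / 3 + 1))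
      = g.support.card * (3 ^ n * 3 ^ (n / 3 + 1)) := by rw [hcard]
    _ ≤ (∑ t, (a t * b t).support.card) * (3 ^ n * 3 ^ (n / 3 + 1)) :=
        Nat.mul_le_mul_right _ hsum
    _ = ∑ t, (a t * b t).support.card * (3 ^ n * 3 ^ (n / 3 + 1)) := Finset.sum_mul _ _ _
    _ ≤ ∑ _t : Fin s, complexity g * M := Finset.sum_le_sum fun t _ => hterm t
    _ = s * (complexity g * M) := by simp
    _ ≤ complexity g * (complexity g * M) := Nat.mul_le_mul_right _ hsL
    _ = complexity g ^ 2 * M := by ring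

end Summit.ValiantsHypothesis.ValiantsHypothesis.Theorems.DivisionGap.PerMultiplesHard.RichFacesDeep

end
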